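import Literature.NumberTheory.LFunctions.HardyZExtremaCriterionProofs
import HarnessLib

/-!
# Kernel bound helper for stub_farField (Dictionary crux)

This file provides the kernel bound `|K(t,ρ)| ≤ 2/(t-γ)²` for `|t-γ| ≥ 1`,
a key helper for the shell decomposition proof of `stub_farField`.

The kernel is `K(t,ρ) = -Im[1/(½+it-ρ) - 1/(2+it-ρ)]` (Titchmarsh §9.6 second proof).
-/

noncomputable section

open Complex Set Filter Topology Classical Real

namespace StubFarFieldHelper

/-- The critical point `½ + it`. -/
def critPt (t : ℝ) : ℂ := 1 / 2 + (t : ℂ) * I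

/-- The comparison point `2 + it`. -/
def cmpPt (t : ℝ) : ℂ := 2 + (t : ℂ) * I

/-- The differenced kernel `K(t,ρ) = −Im[1/(½+it−ρ) − 1/(2+it−ρ)]`. -/
def kernel (t : ℝ) (ρ : ℂ) : ℝ := -((1 / (critPt t - ρ) - 1 / (cmpPt t - ρ)).im)

/-- **Kernel bound**: For `|t − γ| ≥ 1`, `|kernel t ρ| ≤ 2/(t − γ)²`.
This is the key estimate for shell decomposition of the far-field sum. -/
theorem kernel_bound {t : ℝ} {ρ : ℂ} (hne : 1 ≤ |t - ρ.im|) :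
    |kernel t ρ| ≤ 2 / (t - ρ.im) ^ 2 := by
  unfold kernel critPt cmpPt
  set z₁ := (1 : ℂ) / 2 + (t : ℂ) * I - ρ with hz₁
  set z₂ := (2 : ℂ) + (t : ℂ) * I - ρ with hz₂
  have him1 : z₁.im = t - ρ.im := by simp [hz₁]
  have him2 : z₂.im = t - ρ.im := by simp [hz₂]
  have habs_pos : 0 < |t - ρ.im| := by linarith
  have habs1 : |t - ρ.im| ≤ ‖z₁‖ := by rw [← him1]; exact Complex.abs_im_le_norm _
  have habs2 : |t - ρ.im| ≤ ‖z₂‖ := by rw [← him2]; exact Complex.abs_im_le_norm _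
  have hn1 : 0 < ‖z₁‖ := by linarith
  have hn2 : 0 < ‖z₂‖ := by linarith
  have hne1 : z₁ ≠ 0 := fun h => by rw [h] at hn1; simp at hn1
  have hne2 : z₂ ≠ 0 := fun h => by rw [h] at hn2; simp at hn2
  have hdiff : z₂ - z₁ = 3 / 2 := by simp [hz₁, hz₂]; ring
  have hpf : 1 / z₁ - 1 / z₂ = (z₂ - z₁) / (z₁ * z₂) := by field_simp [hne1, hne2]
  rw [hpf, hdiff]
  have hprod : |t - ρ.im| ^ 2 ≤ ‖z₁‖ * ‖z₂‖ := by
    calc |t - ρ.im| ^ 2 = |t - ρ.im| * |t - ρ.im| := sq _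
      _ ≤ ‖z₁‖ * ‖z₂‖ := mul_le_mul habs1 habs2 habs_pos.le (by linarith)
  have hprod_pos : 0 < ‖z₁‖ * ‖z₂‖ := by positivity
  have hpos2 : 0 < |t - ρ.im| ^ 2 := by positivity
  have hnn : ‖z₁ * z₂‖ = ‖z₁‖ * ‖z₂‖ := norm_mul _ _
  have habs_neg : |(-((3 / 2 : ℂ) / (z₁ * z₂)).im)| = |((3 / 2 : ℂ) / (z₁ * z₂)).im| := abs_neg _
  rw [habs_neg]
  have him_le : |((3 / 2 : ℂ) / (z₁ * z₂)).im| ≤ ‖(3 / 2 : ℂ) / (z₁ * z₂)‖ := Complex.abs_im_le_norm _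
  have h32 : ‖(3 / 2 : ℂ)‖ = 3 / 2 := by
    have h1 : (3 / 2 : ℂ) = ((3 / 2 : ℝ) : ℂ) := by push_cast; ring
    rw [h1, Complex.norm_real]; exact abs_of_pos (by norm_num : (0 : ℝ) < 3 / 2)
  have hnorm_div : ‖(3 / 2 : ℂ) / (z₁ * z₂)‖ = 3 / 2 / (‖z₁‖ * ‖z₂‖) := by rw [norm_div, hnn, h32]
  have h1 : |((3 / 2 : ℂ) / (z₁ * z₂)).im| ≤ 3 / 2 / (‖z₁‖ * ‖z₂‖) := him_le.trans (le_of_eq hnorm_div)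
  have h2 : 3 / 2 / (‖z₁‖ * ‖z₂‖) ≤ 3 / 2 / |t - ρ.im| ^ 2 := by gcongr
  have h3 : 3 / 2 / |t - ρ.im| ^ 2 ≤ 2 / |t - ρ.im| ^ 2 := by
    apply div_le_div_of_nonneg_right (by norm_num : (3 : ℝ) / 2 ≤ 2) hpos2.le
  have h4 : 2 / |t - ρ.im| ^ 2 = 2 / (t - ρ.im) ^ 2 := by rw [sq_abs]
  linarith

/-- **Tight kernel bound**: For `|t − γ| ≥ 1`, `|kernel t ρ| ≤ (3/2)/(t − γ)²`.
This is the tighter estimate (vs 2) needed for the far-field bound to fit. -/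
theorem kernel_bound_tight {t : ℝ} {ρ : ℂ} (hne : 1 ≤ |t - ρ.im|) :
    |kernel t ρ| ≤ 3 / 2 / (t - ρ.im) ^ 2 := by
  unfold kernel critPt cmpPt
  set z₁ := (1 : ℂ) / 2 + (t : ℂ) * I - ρ with hz₁
  set z₂ := (2 : ℂ) + (t : ℂ) * I - ρ with hz₂
  have him1 : z₁.im = t - ρ.im := by simp [hz₁]
  have him2 : z₂.im = t - ρ.im := by simp [hz₂]
  have habs_pos : 0 < |t - ρ.im| := by linarith
  have habs1 : |t - ρ.im| ≤ ‖z₁‖ := by rw [← him1]; exact Complex.abs_im_le_norm _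
  have habs2 : |t - ρ.im| ≤ ‖z₂‖ := by rw [← him2]; exact Complex.abs_im_le_norm _
  have hn1 : 0 < ‖z₁‖ := by linarith
  have hn2 : 0 < ‖z₂‖ := by linarith
  have hne1 : z₁ ≠ 0 := fun h => by rw [h] at hn1; simp at hn1
  have hne2 : z₂ ≠ 0 := fun h => by rw [h] at hn2; simp at hn2
  have hdiff : z₂ - z₁ = 3 / 2 := by simp [hz₁, hz₂]; ring
  have hpf : 1 / z₁ - 1 / z₂ = (z₂ - z₁) / (z₁ * z₂) := by field_simp [hne1, hne2]
  rw [hpf, hdiff]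
  have hprod : |t - ρ.im| ^ 2 ≤ ‖z₁‖ * ‖z₂‖ := by
    calc |t - ρ.im| ^ 2 = |t - ρ.im| * |t - ρ.im| := sq _
      _ ≤ ‖z₁‖ * ‖z₂‖ := mul_le_mul habs1 habs2 habs_pos.le (by linarith)
  have hpos2 : 0 < |t - ρ.im| ^ 2 := by positivity
  have hnn : ‖z₁ * z₂‖ = ‖z₁‖ * ‖z₂‖ := norm_mul _ _
  have habs_neg : |(-((3 / 2 : ℂ) / (z₁ * z₂)).im)| = |((3 / 2 : ℂ) / (z₁ * z₂)).im| := abs_neg _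
  rw [habs_neg]
  have him_le : |((3 / 2 : ℂ) / (z₁ * z₂)).im| ≤ ‖(3 / 2 : ℂ) / (z₁ * z₂)‖ := Complex.abs_im_le_norm _
  have h32 : ‖(3 / 2 : ℂ)‖ = 3 / 2 := by
    have h1 : (3 / 2 : ℂ) = ((3 / 2 : ℝ) : ℂ) := by push_cast; ring
    rw [h1, Complex.norm_real]; exact abs_of_pos (by norm_num : (0 : ℝ) < 3 / 2)
  have hnorm_div : ‖(3 / 2 : ℂ) / (z₁ * z₂)‖ = 3 / 2 / (‖z₁‖ * ‖z₂‖) := by rw [norm_div, hnn, h32]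
  have h1 : |((3 / 2 : ℂ) / (z₁ * z₂)).im| ≤ 3 / 2 / (‖z₁‖ * ‖z₂‖) := him_le.trans (le_of_eq hnorm_div)
  have h2 : 3 / 2 / (‖z₁‖ * ‖z₂‖) ≤ 3 / 2 / |t - ρ.im| ^ 2 := by gcongr
  have h3 : 3 / 2 / |t - ρ.im| ^ 2 = 3 / 2 / (t - ρ.im) ^ 2 := by rw [sq_abs]
  linarith

/-- For `|x| ≥ 1`: `2/x² ≤ 4/(1+x²)`. Used for Cauchy-type fallback bounds. -/
lemma two_div_sq_le_four_div_one_add_sq {x : ℝ} (h : 1 ≤ |x|) :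
    2 / x ^ 2 ≤ 4 / (1 + x ^ 2) := by
  have hx2 : 1 ≤ x ^ 2 := by nlinarith [sq_abs x]
  have hpos1 : 0 < x ^ 2 := by positivity
  have hpos2 : 0 < 1 + x ^ 2 := by positivity
  rw [div_le_div_iff₀ hpos1 hpos2]
  nlinarith

end StubFarFieldHelper

end
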